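import Summits.ResolutionOfSingularities.ResolutionOfSingularities.Theorems.MarkedTransferCampaignW46TypedProcedure
import HarnessLib

/-!
# [OURS · L1 W4.6, rung (iii)] The Moh window on curves — regime and rung statements for the TYPED Th. 16.6 procedure
# (cell res-hironaka, LADDER-RESOLUTION rung L, D-0089; slot W4.6, seat res-L1-s46-pv-5; host route MarkedTransfer,
# `--kind definition --supports stmt-ResolutionOfSingularities-16155 --as helper`)

HONEST FRAMING. Every declaration below is OURS (a campaign definition of the res-hironaka cell, slot W4.6 rung (iii)
«purely inseparable `z^p = f` with `ord f < 2p` (Moh window)») over the shared typed-procedure module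
`Theorems/MarkedTransferCampaignW46TypedProcedure.lean` (res-L1-type-o1: `CampaignW46.Regime`, `Step`, `Run`,
`Terminates`); NOTHING here is a statement of H. Hironaka's manuscript *Resolution of singularities in positive
characteristics* (2017-03-23, [Hironaka2017], lit key `paper:url-3343fd9e678b`) and nothing here asserts that any
statement of it holds. The manuscript enters only through the typed CANDIDATE carriers under `CampaignW46` (row 001
`IdealExponent`, `sing`, `transform`; the résumé and centre rule of Th. 16.6 p.84 l.4–8 as typed there). No FACT-LIST
premise is used. AI review is weaker than expert review. STATEMENT-ONLY: no theorem, no `sorry`; the proofs are the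
companion `Theorems/MarkedTransferCampaignW46MohWindowProof.lean` (same seat).

## What is defined (namespace `…Theorems.CampaignW46`)

* `MohWindowAt b R I` — ring level, for a local ring `R` (= `𝒪_{Z,ξ}`) and an ideal `I` (= `J_ξ`): `R` is regular of
  embedding dimension `2` with a regular system of parameters `(x, y)` and `I = (y^b + u·x^d)` with `u` a unit and
  `b < d < 2b` — the plane-curve germ «`y^b = f(x)`, `b < ord f < 2b`». For `b = p` these are the purely inseparable
  germs of the WINDOW ROWS `y^p + xⁿ`, `p < n < 2p`, of kill test K4.6 (res-L0-k46, kit job j258573, verdict ALIVE with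
  boundary `B(p) = 2p`: Eq. (127) holds on exactly these rows and fails at step 1 for `n > 2p`, `p ∤ n`).
* `Regime.mohWindowCurve` — the regime (DESIGN POINT (REG): imposed on the state `(Z, E)` at EVERY stage of a run):
  `Sing(E)` is a finite set of closed points of `Z` and `J_ξ` is a window germ of exponent `b = E.b` at every
  `ξ ∈ Sing(E)`. (For `Z` of finite type over `K` finiteness already forces closedness; both are kept explicit.)
* `MohWindowCurveStepDrop` — OUR replacement of the role of Th. 16.6 (2) / Eq. (127) p.84 l.10–20 in this regime: at
  every step admitted by the typed centre rule from a state in the regime, the number of singular points strictly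
  drops, `#Sing(E′) < #Sing(E)` (OUR invariant is `#Sing`, not the résumé string).
* `MohWindowCurveTerminates` — OUR replacement of the role of the termination clause of Th. 16.13 p.87 l.26–28
  («repeatedly but finitely many times») in this regime: for EVERY notion instance `N` and EVERY `Inv`-reading `Rd`,
  `CampaignW46.Terminates N Rd Regime.mohWindowCurve` — no infinite run of the typed procedure stays in the window.
* `MohWindowCurveExitBound` — the effective form: every run leaves the regime within `#Sing(E₀)` steps.
  (The three rung Props take the characteristic `p` and the base field `K` as parameters; the companion file proves
  them for ALL `p`, `K`.)

## Why quantifying over ALL notion instances is not vacuous here (cf. (VAC) of the shared module; lane-A note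
## res-L1-ref-a2 2026-08-26T20:22:12Z «rung files must NAME the notion instance N»)

The lane note warns that for an instance `N` WITHOUT résumés `Terminates N Rd Rg` holds trivially. The statements
below assert termination for EVERY `N` and `Rd`, hence in particular for the intended instance (rows
006/007/010/015/026/027, whatever selection pins it): the proof (companion file) uses of a run only the blow-up
structure `Step.blowup`, the transform law `Run.E_succ` and the inclusions `D ⊆ ∇(E) ⊆ Sing(E)` of the typed centre
rule (anchor `IsCentre.isPermissibleCentre`) — in the window NO point of `Z′` over the centre is singular for `E′`
and orders off the centre do not change, so `#Sing` strictly drops whatever the résumé is. Outside the window this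
argument is void: for `y^p + xⁿ`, `n > 2p`, the x-chart origin stays singular (K4.6 table), and for `ord = p^e`,
`e ≥ 3`, in `≥ 4` variables the barrier `Literature.Barriers.ResolutionOfSingularities.ResidualOrderUnboundedNarrow`
(`mohStability_fails_for_each_e`) refutes every eventual bound on the uncorrected residual order that is uniform over
point-centre choices — neither is claimed here. The SURFACE window (`z^p + f(x,y)`, `Sing(E)` a curve) is NOT covered:
there the literal centre rule admits point centres on the singular curve (e.g. `z² + xy²`, `p = 2`, reproduces itself
at the x-chart origin), so a surface rung must pin `∇`/`N`; that is the other half of slot W4.6 (iii).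

## References

* `Theorems/MarkedTransferCampaignW46TypedProcedure.lean` (DESIGN POINTS (REG)/(VAC)); plan/RESCUE-SEED.md §1 row W4.6;
  L/res-L0-k46/KILL-TEST-K4.6.md §4 (verdict ALIVE, rider (iii′)); H. Hironaka, ms. 2017-03-23, Th. 16.6 p.84 l.4–20,
  Th. 16.13 p.87 l.26–28, §2.1 p.4 l.35–39, Def. 2.1 p.5 l.2–3 — scope only, under adjudication, not cited as fact.
  [Hironaka2017]
-/

noncomputable section

set_option linter.dupNamespace false -- mandated namespace of this single-conjunct summit

open CategoryTheory AlgebraicGeometry TopologicalSpace IsLocalRing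

namespace Summit.ResolutionOfSingularities.ResolutionOfSingularities.Theorems

namespace CampaignW46

open Literature.AlgebraicGeometry.Resolution
open Literature.AlgebraicGeometry.Hironaka2017.S02Preliminaries
open Literature.AlgebraicGeometry.Hironaka2017.Datum

universe u

/-! ## The window predicate (ring level) -/

/-- [OURS · L1 W4.6 rung (iii)] replaces the role of the hypothesis «purely inseparable `z^p = f` with `ord f < 2p`»
(RESCUE-SEED W4.6 (iii)) READ IN THE STALK at a singular point; NOT a statement of the manuscript. For a local ring `R`
(= `𝒪_{Z,ξ}`), an ideal `I ⊆ R` (= `J_ξ`) and an exponent `b` (= the `b` of `E = (J, b)`): `R` is a regular local ring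
of embedding dimension `2`, and for some regular system of parameters `(x, y)` of `R`, some `d` with `b < d < 2b` and
some unit `u`, `I = (y^b + u·x^d)` — the plane-curve germ «`y^b = f(x)` with `b < ord f < 2b`»; for `b = p` the germs
`y^p + xⁿ`, `p < n < 2p` of the K4.6 window rows. [folklore] -/
def MohWindowAt (b : ℕ) (R : Type u) [CommRing R] [IsLocalRing R] (I : Ideal R) : Prop :=
  IsRegularLocalRing R ∧ (maximalIdeal R).spanFinrank = 2 ∧
    ∃ x y : R, Ideal.span {x, y} = maximalIdeal R ∧
      ∃ (d : ℕ) (u : R), IsUnit u ∧ b < d ∧ d < 2 * b ∧ I = Ideal.span {y ^ b + u * x ^ d}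

/-! ## The regime and the rung statements -/

variable {n : ℕ} {p : ℕ} [Fact p.Prime] {K : Type u} [Field K] [CharP K p]

/-- [OURS · L1 W4.6 rung (iii)] **Regime «Moh window on curves»** — replaces the role of the restriction (iii) of
RESCUE-SEED W4.6 read on the state `(Z, E)` of the typed Th. 16.6 procedure at EVERY stage (DESIGN POINT (REG));
NOT a statement of the manuscript: `Sing(E)` (row 001 `IdealExponent.sing`, `{ξ | b ≤ ord_ξ J}`) is a finite set of
closed points of `Z` (`closedPoints`, p.4 l.34 «`Y_cl`»), and at every `ξ ∈ Sing(E)` the stalk `J_ξ ⊆ 𝒪_{Z,ξ}`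
(`stalkIdeal`) is a window germ of exponent `E.b` (`MohWindowAt`). [folklore] -/
def Regime.mohWindowCurve : Regime p K := fun A E =>
  E.sing.Finite ∧ E.sing ⊆ Literature.AlgebraicGeometry.Hironaka2017.S02Preliminaries.closedPoints A.Z ∧
    ∀ ξ ∈ E.sing, MohWindowAt E.b (A.Z.presheaf.stalk ξ) (stalkIdeal E.J ξ)

/-- [OURS · L1 W4.6 rung (iii)] replaces the role of Th. 16.6 (2) / Eq. (127) p.84 l.10–20 («strict lexicographic
decrease at every point over the centre off `D′`») for the typed procedure in the Moh window on curves, with OUR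
invariant `#Sing(E)` in place of the résumé string; NOT a statement of the manuscript: for every notion instance `N`,
every state `(A, E, R)` with `(A, E) ∈ Regime.mohWindowCurve` and every step `s` admitted by the typed centre rule,
the transform has strictly fewer singular points, `#Sing(E′) < #Sing(E)` (`Set.ncard`; both sets are finite).
[folklore] -/
def MohWindowCurveStepDrop (p : ℕ) [Fact p.Prime] (K : Type u) [Field K] [CharP K p] : Prop :=
  ∀ (n : ℕ) (N : Notions.{u} n) (A A' : AmbientDatum p K) (E : IdealExponent A.Z) (R : Resume N A E)
    (s : Step R A'), Regime.mohWindowCurve (p := p) (K := K) A E → s.E'.sing.ncard < E.sing.ncard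

/-- [OURS · L1 W4.6 rung (iii)] **The rung** — replaces the role of the termination clause of Th. 16.13 p.87 l.26–28
(«repeatedly but finitely many times») for the TYPED Th. 16.6 procedure restricted to the Moh window on curves; NOT a
statement of the manuscript: for EVERY notion instance `N` and EVERY `Inv`-reading `Rd` there is no infinite run of
the typed procedure all of whose stages lie in `Regime.mohWindowCurve` (`CampaignW46.Terminates`). See the module
docstring for why the universal quantification over `N`, `Rd` is contentful. [folklore] -/
def MohWindowCurveTerminates (p : ℕ) [Fact p.Prime] (K : Type u) [Field K] [CharP K p] : Prop :=
  ∀ (n : ℕ) (N : Notions.{u} n) (Rd : Reading p K N), Terminates N Rd (Regime.mohWindowCurve (p := p) (K := K))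

/-- [OURS · L1 W4.6 rung (iii)] the EFFECTIVE form of the rung; NOT a statement of the manuscript: every run of the
typed procedure leaves the regime within `#Sing(E₀)` steps — for every run `r` (any `N`, any `Rd`) there is a stage
`k ≤ #Sing(E₀)` whose state is not in `Regime.mohWindowCurve`. [folklore] -/
def MohWindowCurveExitBound (p : ℕ) [Fact p.Prime] (K : Type u) [Field K] [CharP K p] : Prop :=
  ∀ (n : ℕ) (N : Notions.{u} n) (Rd : Reading p K N) (r : Run N Rd),
    ∃ k ≤ (r.E 0).sing.ncard, ¬ Regime.mohWindowCurve (p := p) (K := K) (r.A k) (r.E k)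

end CampaignW46

end Summit.ResolutionOfSingularities.ResolutionOfSingularities.Theorems

end
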